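import Literature.IUT.HodgeTheaters.FrobeniusEtalePictures
import Literature.IUT.HodgeTheaters.ThetaHodgeTheatersProofs
import HarnessLib

/-!
# [IUTchI] Corollary 3.9 (i), (ii): the étale-picture is full and permutation-symmetric — PROOFS

S. Mochizuki, *Inter-universal Teichmüller theory I*, §3, Corollary 3.9 (i), (ii), p. 92 (kurims
final manuscript May 2020) [claim: Mochizuki2012, status: disputed]. PROOF-ONLY companion of
`Literature/IUT/HodgeTheaters/FrobeniusEtalePictures.lean` (statement module, abc-iut-L5-t2; it
already proves the conditional forms `etalePicture_full`, `etalePermutationSymmetric_of_full`,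
`etalePictureUnits_full`, `etalePermutationSymmetricUnits_of_full` from the Cor. 3.7 "[full]"
claims); no new definitions. Here the Cor. 3.7 inputs are supplied from
`ThetaHodgeTheatersProofs.lean`:

* `etalePictureFull_holds`, `etalePermutationSymmetric_holds` — Cor. 3.9 (i) DISCHARGED ("the
  étale-picture [unlike the Frobenius-picture!] admits arbitrary permutation symmetries among the
  labels"), from the interface law `componentBase_full`;
* `etalePictureFull_of_full`, `etalePermutationSymmetric_of_full'` — the same for any model whose
  base data lift;
* `etalePictureUnits_eq_full_of_full`, `etalePermutationSymmetricUnits_of_full'` — Cor. 3.9 (ii)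
  under the JOINT lifting hypothesis for the pair `(D⊢_v, O^×_{C⊢_v})` (not an interface law).

Nothing here bears on the disputed parts of the series.
-/

namespace Literature.IUT.HodgeTheaters

open CategoryTheory

universe u v w uM

/-! ### Corollary 3.9 (i), (ii): the étale-picture is full and admits all permutation symmetries -/

section Pictures

variable {F : Type u} {K : Type v} {Fbar : Type w} [Field F] [NumberField F] [Field K]
  [NumberField K] [Algebra F K] [Field Fbar] [Algebra F Fbar] [Algebra K Fbar]
  {E : WeierstrassCurve F} [E.IsElliptic] {l : ℕ} {P : BadPlacePredicates K}
  {D : InitialThetaData F K Fbar E l P} {M : HodgeTheaterModel D} (Fr : FrobeniusPicture M)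

namespace FrobeniusPicture

/-- **Cor. 3.9 (i), fullness** of the étale-picture for any model in which the base data lift.
[claim: Mochizuki2012, status: disputed] -/
theorem etalePictureFull_of_full (v : D.V) [(M.component v ⋙ M.base v).Full] :
    Fr.EtalePictureFull v :=
  Fr.etalePicture_full v fun n => (Fr.HT n).thetaLinkBaseFull_of_full (Fr.HT (n + 1)) v

/-- **Cor. 3.9 (i), "the étale-picture admits arbitrary permutation symmetries among the labels
`n ∈ ℤ`"** for any model in which the base data lift. [claim: Mochizuki2012, status: disputed] -/
theorem etalePermutationSymmetric_of_full' (v : D.V) [(M.component v ⋙ M.base v).Full] :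
    Fr.EtalePermutationSymmetric v :=
  Fr.etalePermutationSymmetric_of_full v fun HT HT' => HT.thetaLinkBaseFull_of_full HT' v

/-- **Cor. 3.9 (i), fullness of the étale-picture — DISCHARGED** (chain of full, nonempty
links: Cor. 3.7 (i), (ii) with the interface law). [claim: Mochizuki2012, status: disputed] -/
theorem etalePictureFull_holds (v : D.V) : Fr.EtalePictureFull v :=
  Fr.etalePicture_full v fun n => (Fr.HT n).thetaLinkBaseFull_holds (Fr.HT (n + 1)) v

/-- **Cor. 3.9 (i), "the étale-picture [unlike the Frobenius-picture!] admits arbitrary permutation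
symmetries among the labels `n ∈ ℤ`" — DISCHARGED**. [claim: Mochizuki2012, status: disputed] -/
theorem etalePermutationSymmetric_holds (v : D.V) : Fr.EtalePermutationSymmetric v :=
  Fr.etalePermutationSymmetric_of_full v fun HT HT' => HT.thetaLinkBaseFull_holds HT' v

/-- **Cor. 3.9 (ii), fullness** of the étale-picture plus units, for any model with the joint
lifting property of the pair `(D⊢_v, O^×_{C⊢_v})`. [claim: Mochizuki2012, status: disputed] -/
theorem etalePictureUnits_eq_full_of_full (v : D.V)
    [(M.component v ⋙ (M.base v).prod' (M.units v)).Full] (a b : ℤ) :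
    Fr.etalePictureUnits v a b = PolyIso.full _ _ :=
  Fr.etalePictureUnits_full v (fun HT HT' => HT.thetaLinkPair_eq_full_of_full HT' v) a b

/-- **Cor. 3.9 (ii), permutation symmetries** of the étale-picture plus units, for any model with
the joint lifting property. [claim: Mochizuki2012, status: disputed] -/
theorem etalePermutationSymmetricUnits_of_full' (v : D.V)
    [(M.component v ⋙ (M.base v).prod' (M.units v)).Full] :
    Fr.EtalePermutationSymmetricUnits v :=
  Fr.etalePermutationSymmetricUnits_of_full v fun HT HT' => HT.thetaLinkPair_eq_full_of_full HT' v

end FrobeniusPicture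

end Pictures

end Literature.IUT.HodgeTheaters
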